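import Summits.HodgeConjecture.HodgeConjecture.Theorems.TropicalWeilObstructionTropicalWeilVanishingFrameSpanRank
import HarnessLib

/-!
# Route `TropicalWeilObstruction` (Kontsevich's tropical test — NEGATION SINK, exploration, no summit claim):
# the frame span of an effective tropical `4`-cycle — V. at ANY period, for classes in K3's `3`-space

Negation-sink bookkeeping of the cell `pub-hodge-tropical` (seat tropical-1 gen 6); part V (parts I–IV:
`…FrameSpan{Master,WeilPlane,Rank,Seeds}`). Parts II–IV use genericity of the period only to obtain K3's representation
`cyc Z = q₀ θ₄(Q) + q₁ Re w(Q) + q₂ Im w(Q)` with `q₀ > 0`. This file records the REPRESENTATION-BASED form, valid at EVERY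
period `Q` with `det Q ≠ 0` and `QJ = JQ` (in particular at the standard torus `Q = 1`, where seed candidates are designed;
the formulation of seat tropical-2's referee bar): if an effective tropical `4`-cycle `Z` on `ℝ⁸/Qℤ⁸` has such a
representation with `q₀ ≠ 0`, then

* `annihilator_pairwise_dependent_of_repr` — the annihilator in `ℝ⁷⁰` of its restricted Plücker vectors is at most a line;
* `finrank_span_frames_ge_of_repr`, `card_image_pluckerCoord_ge_of_repr` — its Plücker vectors span `≥ 69` of the `70`
  dimensions of `⋀⁴ℝ⁸`, it has `≥ 69` pairwise distinct Plücker vectors and `≥ 69` cells (and all `70` off the cone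
  boundary: `finrank_span_frames_ge_of_offBoundary`, part III, is already representation-based).

So a design on fewer than `69` rational `4`-planes (e.g. the `64`-plane character design `Z_des` of idea card
`identity-seeds`) can NOT have its class in the `3`-space `⟨θ₄(1), Re w(1), Im w(1)⟩` with `q₀ ≠ 0` — it is not
"(A)-passing". HONEST STATUS. Linear algebra; decides nothing about K1 or the Hodge conjecture. No definition, no named
fact, no sorry.

References: [Zharkov2020TropicalWeil] I. Zharkov, arXiv:2002.02347, §2 (pp. 2–4); [MikhalkinZharkov2014Eigenwave]
G. Mikhalkin, I. Zharkov, LN UMI 15 (2014), Def. 4.2, Prop. 4.3, Thm. 5.4.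
-/

set_option linter.dupNamespace false

noncomputable section

open scoped BigOperators
open Matrix
open Literature.AlgebraicGeometry.Tropical
open Summit.HodgeConjecture.HodgeConjecture.Theorems.TropicalHodgeBound

namespace Summit.HodgeConjecture.HodgeConjecture.Theorems.TropicalWeilVanishing.FrameSpan

/-! ## §0 Display-only notation (the K3 skeleton's local definitions, verbatim bodies; nothing is defined) -/
/-- The skeleton's `thetaClass n Q`. -/
local notation3 (prettyPrint := false) "θ⟦" n "⟧" Q:max =>
  (fun S S' : Fin n → Fin (2 * n) => Matrix.det (Matrix.submatrix Q S S'))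

/-- The skeleton's `omegaFrame n` (`Ω = Pᴴ`). -/
local notation3 (prettyPrint := false) "Ω⟦" n "⟧" =>
  (Matrix.of fun (a : Fin (2 * n)) (b : Fin n) =>
    (if (a : ℕ) = (b : ℕ) then (1 : ℂ) else 0) - (if (a : ℕ) = (b : ℕ) + n then Complex.I else 0))

/-- The skeleton's `weilClassC n Q` (`w(Q) = (⋀ⁿQ ⊗ 1)(Ω ⊗ Ω)`). -/
local notation3 (prettyPrint := false) "wC⟦" n "⟧" Q:max =>
  (fun S S' : Fin n → Fin (2 * n) =>
    Matrix.det (Matrix.submatrix (Matrix.map Q ((↑) : ℝ → ℂ) * Ω⟦n⟧) S id) *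
      Matrix.det (Matrix.submatrix (Ω⟦n⟧) S' id))

/-- The skeleton's `weilClassRe n Q` (`w₁ = Re w`). -/
local notation3 (prettyPrint := false) "wRe⟦" n "⟧" Q:max =>
  (fun S S' : Fin n → Fin (2 * n) => Complex.re ((wC⟦n⟧ Q) S S'))

/-- The skeleton's `weilClassIm n Q` (`w₂ = Im w`). -/
local notation3 (prettyPrint := false) "wIm⟦" n "⟧" Q:max =>
  (fun S S' : Fin n → Fin (2 * n) => Complex.im ((wC⟦n⟧ Q) S S'))

/-- NEW display-only notation: the `Ω`-minor `Ω(S) := det Ω⟦4⟧[S,·] ∈ ℤ[i]` of a word `S` (the value of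
`dz̄₁ ∧ dz̄₂ ∧ dz̄₃ ∧ dz̄₄` on `e_S`). Nothing is defined. -/
local notation3 (prettyPrint := false) "Ωm" S:max => (Matrix.det (Matrix.submatrix (Ω⟦4⟧) S id))

/-! ## §1 The annihilator is at most a line (representation-based) -/

/-- **Annihilators of the restricted frames are pairwise dependent (any period).** If `cyc Z = q₀θ₄(Q) + q₁Re w(Q) + q₂Im w(Q)`
with `q₀ ≠ 0` (`det Q ≠ 0`, `QJ = JQ`), any two vectors of `ℝ⁷⁰` orthogonal to all restricted Plücker vectors
`(p_σ(I_r))_{r<70}` are linearly dependent (same proof as `annihilator_pairwise_dependent`, the representation being a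
hypothesis instead of K3's theorem). [cite: Zharkov2020TropicalWeil, §2] [cite: MikhalkinZharkov2014Eigenwave, Prop. 4.3] -/
theorem annihilator_pairwise_dependent_of_repr {Q : Matrix (Fin (2 * 4)) (Fin (2 * 4)) ℝ} (hQd : IsUnit Q.det)
    (hJ : Q * weilJ 4 = weilJ 4 * Q) (Z : TropicalTorusCycle (2 * 4) 4 Q) (q0 q1 q2 : ℝ)
    (hq' : TropicalTorusCycle.cyc Z = q0 • θ⟦4⟧ Q + q1 • wRe⟦4⟧ Q + q2 • wIm⟦4⟧ Q) (hq0' : q0 ≠ 0)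
    (c₁ c₂ : Fin 70 → ℝ)
    (h₁ : ∀ σ, ∑ r : Fin 70, ((pluckerCoord (Z.cell σ).frame (Chk.wordOfRank r) : ℤ) : ℝ) * c₁ r = 0)
    (h₂ : ∀ σ, ∑ r : Fin 70, ((pluckerCoord (Z.cell σ).frame (Chk.wordOfRank r) : ℤ) : ℝ) * c₂ r = 0) :
    ∃ t : ℝ × ℝ, t ≠ 0 ∧ t.1 • c₁ + t.2 • c₂ = 0 := by
  set lam : ℂ := -(((q1 : ℂ) - Complex.I * (q2 : ℂ)) / (q0 : ℂ)) with hlam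
  set Ωv : Fin 70 → ℂ := fun r => Ωm (Chk.wordOfRank r) with hΩv
  -- the master identity read on increasing words
  have key : ∀ c : Fin 70 → ℝ,
      (∀ σ, ∑ r : Fin 70, ((pluckerCoord (Z.cell σ).frame (Chk.wordOfRank r) : ℤ) : ℝ) * c r = 0) →
      ∀ t : Fin 70, c t = (lam * (∑ r, Ωv r * ((c r : ℝ) : ℂ)) * Ωv t).re := by
    intro c hc t
    have hy : ∀ σ, ∑ S : Fin 4 → Fin (2 * 4), ((pluckerCoord (Z.cell σ).frame S : ℤ) : ℝ) *
        (∑ r : Fin 70, if S = Chk.wordOfRank r then c r else 0) = 0 :=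
      fun σ => by rw [sum_mul_lift]; exact hc σ
    have h := alt_eq_re_of_annihilates hQd hJ Z _ _ _ hq' hq0'
      (fun S => ∑ r : Fin 70, if S = Chk.wordOfRank r then c r else 0) hy (Chk.wordOfRank t)
    beta_reduce at h
    rw [alt_lift, sum_mul_lift_complex] at h
    exact h
  -- the quadratic relation `2 z = lam P z + N conj(lam) conj(z)`
  set P : ℂ := ∑ r, Ωv r * Ωv r with hP
  set N : ℂ := ∑ r, Ωv r * (starRingEnd ℂ) (Ωv r) with hN
  have hE : ∀ (c : Fin 70 → ℝ) (z : ℂ), (∀ t, c t = (lam * z * Ωv t).re) →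
      z = ∑ r, Ωv r * ((c r : ℝ) : ℂ) → 2 * z = lam * P * z + N * (starRingEnd ℂ) lam * (starRingEnd ℂ) z := by
    intro c z hc hz
    have hz' : z = ∑ r, Ωv r * (((lam * z * Ωv r).re : ℝ) : ℂ) := by
      conv_lhs => rw [hz]
      exact Finset.sum_congr rfl fun r _ => by rw [← hc r]
    have hterm : ∀ r, (2 : ℂ) * (Ωv r * (((lam * z * Ωv r).re : ℝ) : ℂ)) =
        lam * (Ωv r * Ωv r) * z + Ωv r * (starRingEnd ℂ) (Ωv r) * (starRingEnd ℂ) lam * (starRingEnd ℂ) z := by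
      intro r
      rw [Complex.re_eq_add_conj, map_mul, map_mul]
      ring
    calc 2 * z = ∑ r, (2 : ℂ) * (Ωv r * (((lam * z * Ωv r).re : ℝ) : ℂ)) := by
          conv_lhs => rw [hz']
          rw [Finset.mul_sum]
      _ = ∑ r, (lam * (Ωv r * Ωv r) * z + Ωv r * (starRingEnd ℂ) (Ωv r) * (starRingEnd ℂ) lam * (starRingEnd ℂ) z) :=
          Finset.sum_congr rfl fun r _ => hterm r
      _ = lam * P * z + N * (starRingEnd ℂ) lam * (starRingEnd ℂ) z := by
          rw [Finset.sum_add_distrib, hP, hN, Finset.mul_sum, Finset.sum_mul, Finset.sum_mul, Finset.sum_mul]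
  -- N is a positive real
  have hN0 : N ≠ 0 := by
    obtain ⟨r₀, hr₀⟩ := exists_omega_wordOfRank_eq_one
    have hNre : N = ((∑ r, Complex.normSq (Ωv r) : ℝ) : ℂ) := by
      rw [hN]; push_cast; exact Finset.sum_congr rfl fun r _ => Complex.mul_conj (Ωv r)
    have hpos : 0 < ∑ r, Complex.normSq (Ωv r) := by
      refine lt_of_lt_of_le ?_ (Finset.single_le_sum (fun r _ => Complex.normSq_nonneg (Ωv r)) (Finset.mem_univ r₀))
      have : Ωv r₀ = 1 := hr₀
      rw [this, Complex.normSq_one]; exact one_pos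
    rw [hNre]; exact_mod_cast hpos.ne'
  set z₁ : ℂ := ∑ r, Ωv r * ((c₁ r : ℝ) : ℂ) with hz₁
  set z₂ : ℂ := ∑ r, Ωv r * ((c₂ r : ℝ) : ℂ) with hz₂
  have hc₁ : ∀ t, c₁ t = (lam * z₁ * Ωv t).re := key c₁ h₁
  have hc₂ : ∀ t, c₂ t = (lam * z₂ * Ωv t).re := key c₂ h₂
  -- trivial case: `c₁ = 0`
  by_cases hz10 : lam * z₁ = 0
  · refine ⟨(1, 0), by simp, ?_⟩
    ext t
    simp only [Pi.add_apply, Pi.smul_apply, smul_eq_mul, one_mul, zero_mul, add_zero, Pi.zero_apply]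
    rw [hc₁ t, hz10, zero_mul, Complex.zero_re]
  have hlam : lam ≠ 0 := fun h => hz10 (by rw [h, zero_mul])
  have hz1 : z₁ ≠ 0 := fun h => hz10 (by rw [h, mul_zero])
  have E₁ := hE c₁ z₁ hc₁ rfl
  have E₂ := hE c₂ z₂ hc₂ rfl
  -- `conj z₁ * z₂` is real
  have hνne : N * (starRingEnd ℂ) lam ≠ 0 := mul_ne_zero hN0 (by simpa using hlam)
  have hreal : (starRingEnd ℂ) z₁ * z₂ = (starRingEnd ℂ) z₂ * z₁ := by
    have e : N * (starRingEnd ℂ) lam * ((starRingEnd ℂ) z₁ * z₂ - (starRingEnd ℂ) z₂ * z₁) = 0 := by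
      have e1 : N * (starRingEnd ℂ) lam * (starRingEnd ℂ) z₁ * z₂ = (2 - lam * P) * z₁ * z₂ := by
        rw [show N * (starRingEnd ℂ) lam * (starRingEnd ℂ) z₁ = 2 * z₁ - lam * P * z₁ by rw [E₁]; ring]; ring
      have e2 : N * (starRingEnd ℂ) lam * (starRingEnd ℂ) z₂ * z₁ = (2 - lam * P) * z₂ * z₁ := by
        rw [show N * (starRingEnd ℂ) lam * (starRingEnd ℂ) z₂ = 2 * z₂ - lam * P * z₂ by rw [E₂]; ring]; ring
      calc N * (starRingEnd ℂ) lam * ((starRingEnd ℂ) z₁ * z₂ - (starRingEnd ℂ) z₂ * z₁)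
          = N * (starRingEnd ℂ) lam * (starRingEnd ℂ) z₁ * z₂ - N * (starRingEnd ℂ) lam * (starRingEnd ℂ) z₂ * z₁ := by
            ring
        _ = 0 := by rw [e1, e2]; ring
    have := (mul_eq_zero.mp e).resolve_left hνne
    exact sub_eq_zero.mp this
  -- `z₂ = t₀ z₁` with `t₀` real
  have hsreal : (starRingEnd ℂ) z₁ * z₂ = (((((starRingEnd ℂ) z₁ * z₂).re : ℝ)) : ℂ) := by
    have hconj : (starRingEnd ℂ) ((starRingEnd ℂ) z₁ * z₂) = (starRingEnd ℂ) z₁ * z₂ := by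
      rw [map_mul, Complex.conj_conj, hreal]; ring
    exact (Complex.conj_eq_iff_re.mp hconj).symm
  obtain ⟨t₀, ht₀⟩ : ∃ t₀ : ℝ, t₀ = ((starRingEnd ℂ) z₁ * z₂).re / Complex.normSq z₁ := ⟨_, rfl⟩
  have hz₂ : z₂ = ((t₀ : ℝ) : ℂ) * z₁ := by
    have hc1 : (starRingEnd ℂ) z₁ ≠ 0 := by simpa using hz1
    have hn : ((Complex.normSq z₁ : ℝ) : ℂ) ≠ 0 := by exact_mod_cast (by simpa using hz1 : Complex.normSq z₁ ≠ 0)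
    apply mul_left_cancel₀ hc1
    have e : (starRingEnd ℂ) z₁ * (((t₀ : ℝ) : ℂ) * z₁) = ((t₀ : ℝ) : ℂ) * (z₁ * (starRingEnd ℂ) z₁) := by ring
    rw [e, Complex.mul_conj, ht₀]
    conv_lhs => rw [hsreal]
    push_cast
    field_simp
  refine ⟨(t₀, -1), by simp, ?_⟩
  ext t
  simp only [Pi.add_apply, Pi.smul_apply, smul_eq_mul, Pi.zero_apply, neg_one_mul]
  have e : lam * (((t₀ : ℝ) : ℂ) * z₁) * Ωv t = ((t₀ : ℝ) : ℂ) * (lam * z₁ * Ωv t) := by ring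
  rw [hc₁ t, hc₂ t, hz₂, e, Complex.re_ofReal_mul]
  ring

/-! ## §2 Rank and counts (representation-based) -/

/-- A test vector killing the representation-based annihilator. [folklore] -/
theorem exists_testVector_of_repr {Q : Matrix (Fin (2 * 4)) (Fin (2 * 4)) ℝ} (hQd : IsUnit Q.det)
    (hJ : Q * weilJ 4 = weilJ 4 * Q) (Z : TropicalTorusCycle (2 * 4) 4 Q) (q0 q1 q2 : ℝ)
    (hq : TropicalTorusCycle.cyc Z = q0 • θ⟦4⟧ Q + q1 • wRe⟦4⟧ Q + q2 • wIm⟦4⟧ Q) (hq0 : q0 ≠ 0) :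
    ∃ v : Fin 70 → ℝ, ∀ c : Fin 70 → ℝ,
      (∀ σ, ∑ r : Fin 70, ((pluckerCoord (Z.cell σ).frame (Chk.wordOfRank r) : ℤ) : ℝ) * c r = 0) →
      ∑ r, v r * c r = 0 → c = 0 := by
  classical
  by_cases h : ∃ c₀ : Fin 70 → ℝ,
      (∀ σ, ∑ r : Fin 70, ((pluckerCoord (Z.cell σ).frame (Chk.wordOfRank r) : ℤ) : ℝ) * c₀ r = 0) ∧ c₀ ≠ 0
  · obtain ⟨c₀, hc₀, hne⟩ := h
    refine ⟨c₀, fun c hc hv => ?_⟩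
    obtain ⟨t, ht, hdep⟩ := annihilator_pairwise_dependent_of_repr hQd hJ Z q0 q1 q2 hq hq0 c₀ c hc₀ hc
    by_cases ht2 : t.2 = 0
    · exfalso
      apply hne
      have ht1 : t.1 ≠ 0 := fun h1 => ht (Prod.ext h1 ht2)
      rw [ht2, zero_smul, add_zero] at hdep
      exact (smul_eq_zero.mp hdep).resolve_left ht1
    · have hc' : c = (-(t.1 / t.2)) • c₀ := by
        ext r
        have e := congrFun hdep r
        simp only [Pi.add_apply, Pi.smul_apply, smul_eq_mul, Pi.zero_apply] at e
        simp only [Pi.smul_apply, smul_eq_mul]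
        field_simp
        linarith
      have hsum : 0 < ∑ r, c₀ r * c₀ r := by
        obtain ⟨r₀, hr₀⟩ : ∃ r, c₀ r ≠ 0 := by
          by_contra hh
          push Not at hh
          exact hne (funext hh)
        exact lt_of_lt_of_le (mul_self_pos.mpr hr₀)
          (Finset.single_le_sum (fun r _ => mul_self_nonneg (c₀ r)) (Finset.mem_univ r₀))
      rw [hc'] at hv
      simp only [Pi.smul_apply, smul_eq_mul] at hv
      have h0 : -(t.1 / t.2) * ∑ r, c₀ r * c₀ r = 0 := by
        rw [Finset.mul_sum, ← hv]
        exact Finset.sum_congr rfl fun r _ => by ring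
      have ht12 : -(t.1 / t.2) = 0 := (mul_eq_zero.mp h0).resolve_right hsum.ne'
      rw [hc', ht12, zero_smul]
  · push Not at h
    exact ⟨0, fun c hc _ => h c hc⟩

/-- **FRAME SPAN AT ANY PERIOD.** If an effective tropical `4`-cycle `Z` on `ℝ⁸/Qℤ⁸` (`det Q ≠ 0`, `QJ = JQ`) has
`cyc Z = q₀θ₄(Q) + q₁Re w(Q) + q₂Im w(Q)` with `q₀ ≠ 0`, its Plücker vectors span `≥ 69` of the `70` dimensions of `⋀⁴ℝ⁸`.
[cite: Zharkov2020TropicalWeil, §2] [cite: MikhalkinZharkov2014Eigenwave, Prop. 4.3 and Thm. 5.4] -/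
theorem finrank_span_frames_ge_of_repr {Q : Matrix (Fin (2 * 4)) (Fin (2 * 4)) ℝ} (hQd : IsUnit Q.det)
    (hJ : Q * weilJ 4 = weilJ 4 * Q) (Z : TropicalTorusCycle (2 * 4) 4 Q) (q0 q1 q2 : ℝ)
    (hq : TropicalTorusCycle.cyc Z = q0 • θ⟦4⟧ Q + q1 • wRe⟦4⟧ Q + q2 • wIm⟦4⟧ Q) (hq0 : q0 ≠ 0) :
    69 ≤ Module.finrank ℝ (Submodule.span ℝ (Set.range fun σ : Fin Z.numCells =>
      fun S : Fin 4 → Fin (2 * 4) => ((pluckerCoord (Z.cell σ).frame S : ℤ) : ℝ))) := by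
  classical
  obtain ⟨v, hv⟩ := exists_testVector_of_repr hQd hJ Z q0 q1 q2 hq hq0
  set P : Fin Z.numCells → ((Fin 4 → Fin (2 * 4)) → ℝ) :=
    fun σ S => ((pluckerCoord (Z.cell σ).frame S : ℤ) : ℝ) with hP
  set ρ : ((Fin 4 → Fin (2 * 4)) → ℝ) →ₗ[ℝ] (Fin 70 → ℝ) :=
    LinearMap.funLeft ℝ ℝ (fun r : Fin 70 => Chk.wordOfRank r) with hρ
  have htop : Submodule.span ℝ (insert v (ρ '' Set.range P)) = ⊤ := by
    refine span_insert_eq_top_of_testVector _ v fun c hc hvc => hv c (fun σ => ?_) hvc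
    have hmem : ρ (P σ) ∈ ρ '' Set.range P := Set.mem_image_of_mem ρ (Set.mem_range_self σ)
    exact hc _ hmem
  have h70 : Module.finrank ℝ (Fin 70 → ℝ) = 70 := Module.finrank_fin_fun ℝ
  have h1 : 70 ≤ Module.finrank ℝ (Submodule.span ℝ ({v} : Set (Fin 70 → ℝ))) +
      Module.finrank ℝ (Submodule.span ℝ (ρ '' Set.range P)) := by
    have h := Submodule.finrank_add_le_finrank_add_finrank (Submodule.span ℝ ({v} : Set (Fin 70 → ℝ)))
      (Submodule.span ℝ (ρ '' Set.range P))
    rw [← Submodule.span_union, Set.singleton_union, htop, finrank_top, h70] at h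
    exact h
  have h2 : Module.finrank ℝ (Submodule.span ℝ ({v} : Set (Fin 70 → ℝ))) ≤ 1 := by
    simpa using finrank_span_le_card ({v} : Set (Fin 70 → ℝ))
  have h3 : Module.finrank ℝ (Submodule.span ℝ (ρ '' Set.range P)) ≤
      Module.finrank ℝ (Submodule.span ℝ (Set.range P)) := by
    rw [Submodule.span_image]
    exact Submodule.finrank_map_le ρ _
  omega

/-- **At any period: `≥ 69` distinct Plücker vectors and `≥ 69` cells** for an effective cycle with class
`q₀θ₄(Q) + q₁Re w(Q) + q₂Im w(Q)`, `q₀ ≠ 0` — so a design on `≤ 68` rational `4`-planes never has its class in K3's `3`-space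
with `q₀ ≠ 0`. [cite: Zharkov2020TropicalWeil, §2] [cite: MikhalkinZharkov2014Eigenwave, Def. 4.2 and Prop. 4.3] -/
theorem card_image_pluckerCoord_ge_of_repr {Q : Matrix (Fin (2 * 4)) (Fin (2 * 4)) ℝ} (hQd : IsUnit Q.det)
    (hJ : Q * weilJ 4 = weilJ 4 * Q) (Z : TropicalTorusCycle (2 * 4) 4 Q) (q0 q1 q2 : ℝ)
    (hq : TropicalTorusCycle.cyc Z = q0 • θ⟦4⟧ Q + q1 • wRe⟦4⟧ Q + q2 • wIm⟦4⟧ Q) (hq0 : q0 ≠ 0) :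
    69 ≤ (Finset.univ.image fun σ : Fin Z.numCells => pluckerCoord (Z.cell σ).frame).card ∧ 69 ≤ Z.numCells := by
  classical
  have h := finrank_span_frames_ge_of_repr hQd hJ Z q0 q1 q2 hq hq0
  set P : Fin Z.numCells → ((Fin 4 → Fin (2 * 4)) → ℝ) :=
    fun σ S => ((pluckerCoord (Z.cell σ).frame S : ℤ) : ℝ) with hP
  have h1 : Module.finrank ℝ (Submodule.span ℝ (Set.range P)) ≤ (Set.range P).toFinset.card :=
    finrank_span_le_card _
  rw [Set.toFinset_range] at h1
  have h2 : (Finset.univ.image P).card ≤ (Finset.univ.image fun σ : Fin Z.numCells => pluckerCoord (Z.cell σ).frame).card := by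
    have e : Finset.univ.image P = (Finset.univ.image fun σ : Fin Z.numCells => pluckerCoord (Z.cell σ).frame).image
        (fun g : (Fin 4 → Fin (2 * 4)) → ℤ => fun S => ((g S : ℤ) : ℝ)) := by
      rw [Finset.image_image]
      rfl
    rw [e]
    exact Finset.card_image_le
  have h3 := Finset.card_image_le (s := (Finset.univ : Finset (Fin Z.numCells)))
    (f := fun σ : Fin Z.numCells => pluckerCoord (Z.cell σ).frame)
  simp only [Finset.card_univ, Fintype.card_fin] at h3
  exact ⟨by omega, by omega⟩


end Summit.HodgeConjecture.HodgeConjecture.Theorems.TropicalWeilVanishing.FrameSpan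

end
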